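import Literature.AlgebraicGeometry.HodgeTheory.CorrespondenceActionHodgeClassesOfGysinResolved
import HarnessLib

/-!
# Hodge compatibility of a Gysin/cycle-class formalism from the Hodge compatibility of its Gysin morphisms

Family `hodge`, layer `Literature/AlgebraicGeometry/HodgeTheory`. Companion to `GysinFormalismHodge`
(the predicate `GysinFormalism.IsHodgeCompatible`: `f_*` rational and of bidegree `(r, r)`; `cl(Z)`
rational and of type `(e, e)`, Voisin I Prop. 11.20) and to
`CorrespondenceActionHodgeClassesOfGysinResolved` (its Gysin half `GysinFormalism.IsGysinHodgeCompatible`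
and `cl[V] = τ_* 1` for a resolution `τ : Ṽ → X` of a prime cycle `V`). This file PROVES that the
two cycle-class fields follow from the two Gysin fields, granted projective Hironaka
(`Resolution.Hironaka1964_projective`) — and, for the Hodge type, Hodge models
(`nonempty_hodgeModel`) and `hodgePQ_independent_of_hodgeModel` (to add Hodge types of the
summands of `cl(Z) = Σᵢ nᵢ τᵢ_* 1` inside ONE Hodge model): Voisin I §11.1.4 defines
"`[Z] ∈ H^{2r}(X, ℤ)` … as `τ_*(1_{Z''})`" and deduces (Prop. 11.20 / Thm. 11.31) that it is an
integral class of type `(r, r)` from "`φ_*` is a morphism of Hodge structures of bidegree `(r, r)`"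
(§7.3.2); here `1_Ṽ ∈ H⁰(Ṽ(ℂ); ℂ)` is rational (`isRationalClass_one`) and of type `(0, 0)`
(`isOfHodgeType_zero_zero_zero`: `H^{0,0}_dR = H⁰_dR`).

Results: `GysinFormalism.IsGysinHodgeCompatible.isRationalClass_cl`, `….isOfHodgeType_cl`,
`….isHodgeCompatible`. No named fact is introduced; consumers of `IsHodgeCompatible`
(`MiddleDimensionReductionProofs`, `Barriers/HodgeConjecture/…GysinLine`, …) can therefore be fed by a
construction establishing the Gysin half only.

## References

* [VoisinHodgeI2002] C. Voisin, Hodge Theory and Complex Algebraic Geometry I, §7.3.2, §11.1.2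
  Prop. 11.20, §11.1.4, Thm. 11.31.
* [Kollar2007] J. Kollár, Lectures on Resolution of Singularities, Thm. 3.27.
* [HatcherAT2002] A. Hatcher, Algebraic Topology, §3.1–§3.2.
-/

noncomputable section

open scoped Manifold ContDiff
open CategoryTheory AlgebraicGeometry
open Literature.AlgebraicTopology.SingularHomology
open Literature.NumberTheory.Transcendental (complexDeRhamCohomology hodgePQ IsOfType cclosedSmoothForms)

namespace Literature.AlgebraicGeometry.HodgeTheory

section HodgeTheory

universe u

variable {n : ℕ} {X : Motives.SchemeOver ℂ}

/-! ### The unit class: rational and of type `(0, 0)` -/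

/-- The unit `1 ∈ H⁰(Y; ℂ)` is a rational class (it is the class of the constant cocycle `1 ∈ ℚ`).
[cite: HatcherAT2002, §3.2 p. 211] -/
theorem isRationalClass_one (Y : Type u) [TopologicalSpace Y] :
    IsRationalClass (singularCohomology.one ℂ Y) :=
  ⟨_, rfl, fun σ ↦ ⟨1, by rw [singularCochainComplex.iCocycles_mk, map_one]; rfl⟩⟩

/-- Every `0`-form is of type `(0, 0)` (there are no tangent vectors to rotate). [cite: VoisinHodgeI2002, §2.3.1] -/
theorem isOfType_zero_zero_of_degree_zero {E : Type*} [NormedAddCommGroup E] [NormedSpace ℂ E]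
    {M : Type*} [TopologicalSpace M] [ChartedSpace E M]
    (α : Literature.Geometry.Kaehler.MForm 𝓘(ℝ, E) M ℂ 0) : IsOfType 0 0 α := by
  refine ⟨rfl, fun x θ v ↦ ?_⟩
  have hv : (fun i ↦ Literature.NumberTheory.Transcendental.tangentRotate E x θ (v i)) = v :=
    funext fun i ↦ Fin.elim0 i
  rw [hv]
  simp

/-- On any manifold, `H^{0,0}_dR = H⁰_dR` (every degree-`0` class is the class of a closed `0`-form,
which is of type `(0,0)`). [cite: VoisinHodgeI2002, §6.1] -/
theorem hodgePQ_zero_zero_zero_eq_top {E : Type*} [NormedAddCommGroup E] [NormedSpace ℂ E]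
    {M : Type*} [TopologicalSpace M] [ChartedSpace E M] :
    hodgePQ E M 0 0 0 = ⊤ := by
  refine eq_top_iff.mpr fun u _ ↦ ?_
  obtain ⟨β, rfl⟩ := Submodule.Quotient.mk_surjective _ u
  exact Submodule.subset_span ⟨β, isOfType_zero_zero_of_degree_zero _, rfl⟩

/-- **Every class of `H⁰(X(ℂ); ℂ)` is of Hodge type `(0, 0)`** as soon as `X` has a Hodge model
(`H^{0,0} = H⁰`). In particular `1_X` is of type `(0,0)`. [cite: VoisinHodgeI2002, §6.1 and §7.1.1] -/
theorem isOfHodgeType_zero_zero_zero (A : HodgeModel n X) (c : complexBetti X 0) :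
    IsOfHodgeType n X 0 0 0 c := by
  refine ⟨A, ?_⟩
  change A.pullback 0 c ∈ (hodgePQ A.model A.carrier 0 0 0).map (A.deRham A.carrier 0).toLinearMap
  rw [hodgePQ_zero_zero_zero_eq_top, Submodule.map_top, LinearEquiv.range]
  trivial

/-! ### Additivity of `cl` over prime cycles -/

/-- **`cl Z` lies in an additive subgroup as soon as `cl[V]` does for every prime cycle `[V]` of the
support of `Z`**: `Z = Σ_z Z(z)·[closure z]` over its finite support (`X` is compact) and `cl` is
additive. [cite: Fulton1998, §1.3 and §19.1] -/
theorem GysinFormalism.cl_mem_of_primeCycle (G : GysinFormalism) (hX : Motives.IsSmoothProjective n X)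
    {d e : ℕ} (hde : d + e = n) (S : AddSubgroup (complexBetti X (2 * e)))
    (Z : ↥(Motives.cyclesOfDim X.left d))
    (h : ∀ z, (Z : AlgebraicCycle X.left ℤ) z ≠ 0 →
      ∀ hz : Motives.primeCycle z ∈ Motives.cyclesOfDim X.left d, G.cl hX hde ⟨Motives.primeCycle z, hz⟩ ∈ S) :
    G.cl hX hde Z ∈ S := by
  classical
  have hfin := finite_support_of_isSmoothProjective hX (Z : AlgebraicCycle X.left ℤ)
  have hmem : ∀ z ∈ hfin.toFinset, Motives.primeCycle z ∈ Motives.cyclesOfDim X.left d :=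
    fun z hzS ↦ Motives.primeCycle_mem_cyclesOfDim
      (Z.2 z (Function.mem_support.mp (hfin.mem_toFinset.mp hzS)))
  have hdec : Z = ∑ z ∈ hfin.toFinset.attach,
      (Z : AlgebraicCycle X.left ℤ) z.1 • (⟨Motives.primeCycle z.1, hmem z.1 z.2⟩ :
        ↥(Motives.cyclesOfDim X.left d)) := by
    apply Subtype.ext
    rw [AddSubmonoidClass.coe_finsetSum]
    simp only [AddSubgroupClass.coe_zsmul]
    rw [Finset.sum_attach hfin.toFinset (fun z ↦ (Z : AlgebraicCycle X.left ℤ) z • Motives.primeCycle z)]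
    exact eq_sum_support_smul_primeCycle _ hfin
  rw [hdec, map_sum]
  refine S.sum_mem fun z _ ↦ ?_
  rw [map_zsmul]
  exact S.zsmul_mem (h z.1 (Function.mem_support.mp (hfin.mem_toFinset.mp z.2)) (hmem z.1 z.2)) _

/-! ### The cycle-class fields from the Gysin fields -/

namespace GysinFormalism.IsGysinHodgeCompatible

variable {G : GysinFormalism} (hG : G.IsGysinHodgeCompatible)
include hG

/-- **`cl(Z)` is a rational class**, from the rationality of Gysin images and projective Hironaka:
`cl[V] = τ_* 1_Ṽ` for a resolution `τ : Ṽ → X` of each prime cycle `V` of `Z`, `1_Ṽ` is rational, and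
rational classes form an additive subgroup. [cite: VoisinHodgeI2002, §11.1.4 and §7.3.2]
[cite: Kollar2007, Thm. 3.27] -/
theorem isRationalClass_cl (hH : Resolution.Hironaka1964_projective.{0})
    (hX : Motives.IsSmoothProjective n X) {d e : ℕ} (hde : d + e = n)
    (Z : ↥(Motives.cyclesOfDim X.left d)) : IsRationalClass (G.cl hX hde Z) := by
  let S : AddSubgroup (complexBetti X (2 * e)) :=
    { carrier := {c | IsRationalClass c}
      add_mem' := fun ha hb ↦ ha.add hb
      zero_mem' := IsRationalClass.zero
      neg_mem' := fun {c} hc ↦ by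
        have h := hc.smul (-1)
        rwa [Rat.cast_neg, Rat.cast_one, neg_one_smul] at h }
  change G.cl hX hde Z ∈ S
  refine G.cl_mem_of_primeCycle hX hde S Z fun z hz0 hz ↦ ?_
  obtain ⟨V, τ, η, hV, hηg, hηd, hτ⟩ := exists_resolution_primeCycle hH hX z (Z.2 z hz0)
  haveI : QuasiCompact τ.left := by
    haveI := isProper_left_of_isSmoothProjective hV hX τ
    infer_instance
  have hη : Motives.primeCycle η ∈ Motives.cyclesOfDim V.left d := Motives.primeCycle_mem_cyclesOfDim hηd
  have hτ' : Motives.cyclesOfDimMap d τ.left ⟨Motives.primeCycle η, hη⟩ = ⟨Motives.primeCycle z, hz⟩ :=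
    Subtype.ext hτ
  change IsRationalClass _
  rw [G.cl_primeCycle_eq_gysin_one hX hV τ hde z hz η hηg hη hτ']
  exact hG.isRationalClass_gysin hV hX τ _ (isRationalClass_one _)

/-- **`cl(Z)` is of type `(e, e)` for `Z` of codimension `e`** (Voisin I, Prop. 11.20), from the
bidegree of Gysin morphisms and projective Hironaka: `cl[V] = τ_* 1_Ṽ` with `1_Ṽ` of type `(0,0)` and
`τ_*` of bidegree `(e, e)`; the summands are added inside one Hodge model of `X` (`hM`), legitimately
by `hodgePQ_independent_of_hodgeModel` (`hI`). [cite: VoisinHodgeI2002, §11.1.2 Prop. 11.20, §11.1.4 and §7.3.2]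
[cite: Kollar2007, Thm. 3.27] -/
theorem isOfHodgeType_cl (hH : Resolution.Hironaka1964_projective.{0})
    (hI : hodgePQ_independent_of_hodgeModel)
    (hM : ∀ (m : ℕ) (Y : Motives.SchemeOver ℂ), nonempty_hodgeModel m Y)
    (hX : Motives.IsSmoothProjective n X) {d e : ℕ} (hde : d + e = n)
    (Z : ↥(Motives.cyclesOfDim X.left d)) : IsOfHodgeType n X (2 * e) e e (G.cl hX hde Z) := by
  obtain ⟨A⟩ := (hM n X).nonempty hX
  rw [hI.isOfHodgeType_iff hX A]
  let S : AddSubgroup (complexBetti X (2 * e)) :=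
    ((A.hodgePQ (2 * e) e e).comap (A.pullback (2 * e)).hom).toAddSubgroup
  change G.cl hX hde Z ∈ S
  refine G.cl_mem_of_primeCycle hX hde S Z fun z hz0 hz ↦ ?_
  obtain ⟨V, τ, η, hV, hηg, hηd, hτ⟩ := exists_resolution_primeCycle hH hX z (Z.2 z hz0)
  haveI : QuasiCompact τ.left := by
    haveI := isProper_left_of_isSmoothProjective hV hX τ
    infer_instance
  have hη : Motives.primeCycle η ∈ Motives.cyclesOfDim V.left d := Motives.primeCycle_mem_cyclesOfDim hηd
  have hτ' : Motives.cyclesOfDimMap d τ.left ⟨Motives.primeCycle η, hη⟩ = ⟨Motives.primeCycle z, hz⟩ :=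
    Subtype.ext hτ
  obtain ⟨B⟩ := (hM d V).nonempty hV
  change A.pullback (2 * e) _ ∈ A.hodgePQ (2 * e) e e
  rw [← hI.isOfHodgeType_iff hX A, G.cl_primeCycle_eq_gysin_one hX hV τ hde z hz η hηg hη hτ']
  exact hG.isOfHodgeType_gysin hV hX τ _ (p := 0) (q := 0) (by omega) (by omega)
    (isOfHodgeType_zero_zero_zero B _)

/-- **Hodge compatibility from the Gysin half**: granted projective Hironaka, Hodge models and
`hodgePQ_independent_of_hodgeModel`, a formalism whose Gysin morphisms are Hodge compatible is Hodge
compatible (`GysinFormalism.IsHodgeCompatible`). [cite: VoisinHodgeI2002, §7.3.2 and §11.1.2 Prop. 11.20] -/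
theorem isHodgeCompatible (hH : Resolution.Hironaka1964_projective.{0})
    (hI : hodgePQ_independent_of_hodgeModel)
    (hM : ∀ (m : ℕ) (Y : Motives.SchemeOver ℂ), nonempty_hodgeModel m Y) : G.IsHodgeCompatible where
  isRationalClass_gysin := hG.isRationalClass_gysin
  isOfHodgeType_gysin := hG.isOfHodgeType_gysin
  isRationalClass_cl hX _ _ hde Z := hG.isRationalClass_cl hH hX hde Z
  isOfHodgeType_cl hX _ _ hde Z := hG.isOfHodgeType_cl hH hI hM hX hde Z

end GysinFormalism.IsGysinHodgeCompatible

end HodgeTheory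

end Literature.AlgebraicGeometry.HodgeTheory

end
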